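import Summits.BirchSwinnertonDyer.BirchSwinnertonDyer.Theses.InertBadSignedBranches
import Summits.BirchSwinnertonDyer.BirchSwinnertonDyer.Theses.BiquadraticEisensteinDescent
import Summits.BirchSwinnertonDyer.BirchSwinnertonDyer.Theorems.InertBadSignedBranchesInertBadAtThreeBedLinks
import HarnessLib

set_option linter.dupNamespace false -- `Summit.BirchSwinnertonDyer.BirchSwinnertonDyer.Theorems.…` (summit = sub, D-0017)
set_option autoImplicit false

/-!
# Line `bed_at_three` (crux `InertBadAtThree`, stmt-BirchSwinnertonDyer-19225): the GLUE — BED's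
# `closes` re-run at `p = 3` through the STEP-L ⇒ BSD₃ lemma, from the four stub statements BY VALUE

Companion of `…InertBadAtThreeBedLinks.lean` (the ported links: control C″, ♭-frame, odd density-one
switch, halves algebra). THEOREMS ONLY (no definition, no named fact, no `sorry`): the composition of
the crux-line skeleton `Cruxes/InertBadAtThree/Lines/bed_at_three.lean` (ideator bsd-idea-18 g3, lead
`bsd-line-ibd-p1` g4) with its four stub statements taken as HYPOTHESES BY VALUE (the skeleton's
`def`s `PrintedInputsAtThree`, `NonNullOddIndivisibleHeegnerThree`, `ManinAtThree`, `HeartAtThree`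
inlined; the frame `FrameAtThree` is discharged by the links file's `frameAtThree`):

* `bsdp_three_of_links` — `BSDp W 3` for every CM curve `W` of analytic rank one with CM-inert bad `3`
  from (printed inputs) + C⁺odd(N,3) + R₃ (Manin at 3) + E_K′@3 (heart): isogenous optimal curve
  (`X12.exists_isIsogenous_optimal`), Heegner field from the odd density-one switch, Heegner datum and
  point, ♭-frame + control + heart ⇒ `2·v₃(index) ≤ v₃(#Ш[3^∞]) + v₃(Tam)` by the halves algebra, then
  `X12.bsdp_of_classX12_of_bad_odd_of_indexLowerBoundAt` (`3 ∤ Tam` by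
  `X12.not_three_dvd_tamagawaProduct_of_hasCM_of_not_cmRamified_three`, `3 ∤ w_{K′}` by
  `X12.not_dvd_torsionOrder_of_four_lt_natAbs_discr`) and isogeny invariance (`Wuthrich2014.bsdp_of_isIsogenous`);
* `inertBadAtThree_of_links` — the crux decl `InertBadSignedBranches.InertBadAtThree` BY NAME from the
  four statements (`Typed.missingPPartAt_of_bsdp`, `Ш` finite by GZK);
* `inertBadAtThree_bed_of_links` — the same for route BED's copy `BiquadraticEisensteinDescent.InertBadAtThree`.

Status of the four hypotheses (lead's census, 2026-08-28): printed inputs HELD (print, by name);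
C⁺odd(N,3) PROVED modulo the Bhargava–Varma mean (`…InertBadAtThreeNonNullOddHeegner.lean` +
`Literature/…/ThreeTorsionMeanHeegner.lean`); R₃ reduced to its off-`I₀*` residual
(`…InertBadAtThreeBedManinIstar.lean`); E_K′@3 OPEN (research; `p = 3` excluded in print: Hsieh JAMS 27
L.7.15/P.7.16 + hyp (1), arXiv:2508.19706 Thm 1.4/1.6). BSD is not proved by any of this; 19225 is
not closed by this file.
-/

noncomputable section

open scoped Classical

open WeierstrassCurve Literature.NumberTheory.EllipticCurves Literature.NumberTheory.EllipticCurves.Rank1Residual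

namespace Summit.BirchSwinnertonDyer.BirchSwinnertonDyer.Theorems.InertBadSignedBranchesInertBadAtThreeBedGlue

open Summit.BirchSwinnertonDyer.BirchSwinnertonDyer.Theses
open Summit.BirchSwinnertonDyer.BirchSwinnertonDyer.Theorems.InertBadSignedBranchesInertBadAtThreeBedLinks

/-! ## The composition: BED's `closes` re-run at `p = 3` through the `p = 3` STEP-L lemma -/

/-- **BSD(E,3) for a CM curve of analytic rank one with CM-inert bad 3, from the four stub statements (by value)**
(frame, control, switch and halves algebra from `…InertBadAtThreeBedLinks`; everything else by name from the tree). This is BED's `closes` with `p := 3`,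
`X12.bsdp_of_classX12_of_not_cmRamified_of_indexLowerBoundAt` (p ≥ 5) replaced by
`X12.bsdp_of_classX12_of_bad_odd_of_indexLowerBoundAt` (p odd, `d_{K′}` odd, `3 ∤ Tam`), the Tamagawa identities by their
every-prime versions, and the supply by the odd density-one switch + C⁺odd(N,3). -/
theorem bsdp_three_of_links
    (hI : BiquadraticEisensteinDescent.PublishedInputsBiquadratic ∧ BiquadraticEisensteinDescent.HsiehAnyLevelInput ∧
    BiquadraticEisensteinDescent.HsiehMuInvariantInput ∧ BiquadraticEisensteinDescent.LiuZhangZhangAdditiveInput ∧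
    Literature.NumberTheory.EllipticCurves.burungaleTian_analyticRank_eq_zero_of_selmerCorank_eq_zero_of_hasCM ∧
    Literature.NumberTheory.EllipticCurves.monsky_selmerCorank_two_mod_two_eq ∧
    (∀ (W : WeierstrassCurve ℚ) [W.IsElliptic], W.HasCM → Literature.NumberTheory.EllipticCurves.smith_selmerCorank_density W))
    (hC : ∀ (N : ℕ), N ≠ 0 → ¬ Literature.NumberTheory.EllipticCurves.twistDensity (fun d : ℤ ↦ ∃ (K : Type) (_ : Field K) (_ : NumberField K), Literature.NumberTheory.EllipticCurves.IsImaginaryQuadratic K ∧ NumberField.discr K = d ∧ 4 < d.natAbs ∧ Odd d ∧ Literature.NumberTheory.EllipticCurves.SatisfiesHeegnerHypothesis N K ∧ ¬ 3 ∣ NumberField.classNumber K) 0)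
    (hR : ∀ (W : WeierstrassCurve ℚ) [W.IsElliptic] [W.IsGloballyMinimal] [NeZero (W.conductorNorm ℤ)] (p : ℕ) [Fact p.Prime] (D : Literature.NumberTheory.EllipticCurves.ModularForms.ModularParametrizationData W (W.conductorNorm ℤ)), W.HasCM → W.analyticRank = 1 → p = 3 → Literature.NumberTheory.EllipticCurves.Rank1Residual.CMInert W p → ¬ Literature.NumberTheory.EllipticCurves.Rank1Residual.Good W p → (∀ z ∈ D.L.lattice, ∃ w ∈ Literature.NumberTheory.EllipticCurves.ModularForms.periodLattice D.f, z = D.c * w) → ¬ (p : ℤ) ∣ D.c)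
    (hE : Literature.NumberTheory.EllipticCurves.Hsieh2014.thmB_exists_isHsiehLFunction_coeff_norm_eq_one_unrPeriod_anyLevel → ∀ (W : WeierstrassCurve ℚ) [W.IsElliptic] [W.IsGloballyMinimal] (p : ℕ) [Fact p.Prime] [NeZero (W.conductorNorm ℤ)] (K : Type) [Field K] [NumberField K], W.HasCM → W.analyticRank = 1 → p = 3 → Literature.NumberTheory.EllipticCurves.Rank1Residual.CMInert W p → ¬ Literature.NumberTheory.EllipticCurves.Rank1Residual.Good W p → Literature.NumberTheory.EllipticCurves.IsImaginaryQuadratic K → Literature.NumberTheory.EllipticCurves.SatisfiesHeegnerHypothesis (W.conductorNorm ℤ) K → 4 < (NumberField.discr K).natAbs → ¬ p ∣ NumberField.classNumber K → (W.quadraticTwist (NumberField.discr K : ℚ)).entireLFunction 1 ≠ 0 → ∀ (κ : Literature.NumberTheory.EllipticCurves.ZpExtension K p), κ.IsAnticyclotomic → ∀ (γ : Field.absoluteGaloisGroup K) [Fact (κ.IsTopGenerator γ)] (𝔭 : IsDedekindDomain.HeightOneSpectrum (NumberField.RingOfIntegers K)), ((p : ℕ) : NumberField.RingOfIntegers K)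 ∈ 𝔭.asIdeal → 𝔭.asIdeal.ramificationIdx (NumberField.RingOfIntegers ℚ) = 1 → 𝔭.asIdeal.inertiaDeg (NumberField.RingOfIntegers ℚ) = 1 → ∀ (𝔭' : IsDedekindDomain.HeightOneSpectrum (NumberField.RingOfIntegers K)), ((p : ℕ) : NumberField.RingOfIntegers K) ∈ 𝔭'.asIdeal → 𝔭' ≠ 𝔭 → Module.IsTorsion (Literature.NumberTheory.EllipticCurves.IwasawaAlgebra p) (Summit.BirchSwinnertonDyer.Rank1Residual.X11b.AcSelmer.XAc (W.baseChange K) p κ 𝔭' ∅ γ) → ∀ (f : CuspForm (CongruenceSubgroup.Gamma0 (W.conductorNorm ℤ)) 2), Literature.NumberTheory.EllipticCurves.ModularForms.IsNewformOf W f → ∀ (ι' : PadicAlgCl p ≃+* ℂ), (∀ (w : NumberField.InfinitePlace K) (k : NumberField.RingOfIntegers K), k ∈ 𝔭.asIdeal ↔ ‖ι'.symm (w.embedding (k : K))‖ < 1) → ∀ (ΩK : ℂ) (Ωp : (Literature.NumberTheory.EllipticCurves.unrIntegers p)ˣ) (Q : PowerSeries (PadicComplexInt p)), ΩK ≠ 0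 → Summit.BirchSwinnertonDyer.Rank1Residual.X11b.R1.IsBDPLFunctionInt p ι' 𝔭 κ γ f ΩK ((Ωp : Literature.NumberTheory.EllipticCurves.unrIntegers p) : (PadicComplex p)) Q → (Summit.BirchSwinnertonDyer.Rank1Residual.X11b.AcSelmer.XAc.charIdeal (W.baseChange K) p κ 𝔭' ∅ γ).map ((Summit.BirchSwinnertonDyer.Rank1Residual.X11b.R1.toCpInt p).comp (PowerSeries.constantCoeff : Literature.NumberTheory.EllipticCurves.IwasawaAlgebra p →+* ℤ_[p])) ≤ Ideal.span {PowerSeries.constantCoeff Q})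
    (W : WeierstrassCurve ℚ) [W.IsElliptic] [W.IsGloballyMinimal]
    [Fact (Nat.Prime 3)] (hCM : W.HasCM) (hr : W.analyticRank = 1)
    (hin : Literature.NumberTheory.EllipticCurves.Rank1Residual.CMInert W 3)
    (hbad : ¬ Literature.NumberTheory.EllipticCurves.Rank1Residual.Good W 3) :
    Literature.NumberTheory.EllipticCurves.BSDp W 3 := by
  obtain ⟨⟨hGZ, hKo, hMN, hGZK, hmod, hnf, hFH, hCM8, -, -, hCassels⟩, h8, h9, h10, hBT, hMon, hSmith⟩ := hI
  have hp : (3 : ℕ).Prime := Fact.out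
  obtain ⟨W₀, _, _, _, D₀, hiso, hN0, hopt⟩ :=
    Summit.BirchSwinnertonDyer.Rank1Residual.X12.exists_isIsogenous_optimal hnf W
  have hCM0 : W₀.HasCM :=
    (Summit.BirchSwinnertonDyer.Rank1Residual.X12.hasCM_iff_of_isIsogenous hiso).mp hCM
  have hin0 : Literature.NumberTheory.EllipticCurves.Rank1Residual.CMInert W₀ 3 :=
    (Summit.BirchSwinnertonDyer.Rank1Residual.X12.cmInert_iff_of_isIsogenous hiso hCM 3).mp hin
  have hX : Literature.NumberTheory.EllipticCurves.Rank1Residual.ClassX12 W 3 :=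
    ⟨hCM, hr, Or.inr (Or.inr (Or.inr hbad))⟩
  have hX0 : Literature.NumberTheory.EllipticCurves.Rank1Residual.ClassX12 W₀ 3 :=
    (Summit.BirchSwinnertonDyer.Rank1Residual.X12.classX12_iff_of_isIsogenous hiso 3).mp hX
  have hr0 : W₀.analyticRank = 1 := hX0.2.1
  have hpN : 3 ∣ W.conductorNorm ℤ :=
    (W.dvd_conductorNorm_iff_not_hasGoodReductionAtPrime 3).mpr hbad
  have hpN0 : 3 ∣ W₀.conductorNorm ℤ := hN0 ▸ hpN
  have hbad0 : ¬ Literature.NumberTheory.EllipticCurves.Rank1Residual.Good W₀ 3 :=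
    (W₀.dvd_conductorNorm_iff_not_hasGoodReductionAtPrime 3).mp hpN0
  have hc0 : ¬ ((3 : ℕ) : ℤ) ∣ D₀.c := hR W₀ 3 D₀ hCM0 hr0 rfl hin0 hbad0 hopt
  have htam : ¬ 3 ∣ W₀.tamagawaProduct :=
    Summit.BirchSwinnertonDyer.Rank1Residual.X12.not_three_dvd_tamagawaProduct_of_hasCM_of_not_cmRamified_three W₀
      hCM0 hin0.1
  have hb0 : Literature.NumberTheory.EllipticCurves.BSDp W₀ 3 := by
    obtain ⟨K, _, _, hK, hd4, hodd, hHN, hLt, hhK⟩ :=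
      exists_heegnerField_oddTwist_L_one_ne_zero_of_nonNull hnf hBT hMon W₀ 3 hCM0 hr0 (hSmith W₀ hCM0)
        (hC (W₀.conductorNorm ℤ) (NeZero.ne _))
    obtain ⟨β, hβ⟩ :=
      Literature.NumberTheory.EllipticCurves.exists_dvd_sq_sub_discr_holds (W₀.conductorNorm ℤ) K hK hHN
    obtain ⟨H, -⟩ :=
      Literature.NumberTheory.EllipticCurves.nonempty_heegnerDatum_holds (W₀.conductorNorm ℤ) K hK hβ
    obtain ⟨ι⟩ : Nonempty (K →+* ℂ) := inferInstance
    obtain ⟨P, hP⟩ :=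
      Literature.NumberTheory.EllipticCurves.heegnerPointComplex_mem_range_map_holds
        (W₀.conductorNorm ℤ) W₀ K hK hHN D₀ H ι
    have hμ : ¬ 3 ∣ NumberField.Units.torsionOrder K :=
      Summit.BirchSwinnertonDyer.Rank1Residual.X12.not_dvd_torsionOrder_of_four_lt_natAbs_discr 3
        (le_refl 3) K hK hd4
    refine Summit.BirchSwinnertonDyer.Rank1Residual.X12.bsdp_of_classX12_of_bad_odd_of_indexLowerBoundAt
      hGZ hKo hMN hGZK hmod hnf hFH hCM8 W₀ 3 K D₀ H ι P hX0 (by decide) hbad0 hin0.1 hK hodd hHN hP hc0 hμ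
      hLt htam ?_
    intro hfin
    have hPinf : ¬ IsOfFinAddOrder P :=
      (Literature.NumberTheory.EllipticCurves.lDerivEK_ne_zero_iff_not_isOfFinAddOrder W₀ _ K (hGZ _ W₀ K) hK hHN
        ⟨D₀, H, ι, hP⟩).mp (by
        rw [Literature.NumberTheory.EllipticCurves.lDerivEK_eq_deriv_mul_of_entireLFunction_one_eq_zero hmod W₀ K
          (Literature.NumberTheory.EllipticCurves.entireLFunction_one_eq_zero_of_analyticRank_eq_one hr0)]
        exact mul_ne_zero
          (Literature.NumberTheory.EllipticCurves.leadingLCoeff_eq_deriv_of_analyticRank_eq_one hr0).2 hLt)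
    obtain ⟨κ, γ, 𝔭, hκ, hγ, h𝔭, he, hf⟩ :=
      Summit.BirchSwinnertonDyer.Rank1Residual.X11b.exists_anticyclotomic_generator_degreeOnePrime 3 K
        hK (hHN.of_dvd hpN0)
    haveI : Fact (κ.IsTopGenerator γ) := ⟨hγ⟩
    obtain ⟨𝔭', h𝔭', hne'⟩ : ∃ 𝔭' : IsDedekindDomain.HeightOneSpectrum (NumberField.RingOfIntegers K),
        ((3 : ℕ) : NumberField.RingOfIntegers K) ∈ 𝔭'.asIdeal ∧ 𝔭' ≠ 𝔭 := by
      have hs : Summit.BirchSwinnertonDyer.Rank1Residual.X11b.SplitsIn K 3 :=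
        (hHN.of_dvd hpN0) 3 hp (dvd_refl 3)
      have hv := Summit.BirchSwinnertonDyer.Rank1Residual.X11b.under_eq_ratPlace_of_mem (K := K) (p := 3) h𝔭
      have hcard : {w : IsDedekindDomain.HeightOneSpectrum (NumberField.RingOfIntegers K) |
          w.under (NumberField.RingOfIntegers ℚ) =
            Summit.BirchSwinnertonDyer.Rank1Residual.X11b.ratPlace 3}.ncard = 2 := by
        rw [← Summit.BirchSwinnertonDyer.Rank1Residual.X11b.ncard_primesOver_span_eq K
            (Summit.BirchSwinnertonDyer.Rank1Residual.X11b.ratPlace 3),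
          Summit.BirchSwinnertonDyer.Rank1Residual.X11b.primesEquiv_ratPlace]
        exact hs
      rcases Literature.NumberTheory.EllipticCurves.placesOver_trichotomy_of_finrank_eq_two K hK.1
          (Summit.BirchSwinnertonDyer.Rank1Residual.X11b.ratPlace 3) with
        ⟨w₁, w₂, hne, hset, -⟩ | ⟨w, hset, -, -⟩ | ⟨w, hset, -, -⟩
      · have hmem𝔭 : 𝔭 ∈ ({w₁, w₂} : Set (IsDedekindDomain.HeightOneSpectrum (NumberField.RingOfIntegers K))) :=
          hset ▸ hv
        have hw₁ : w₁ ∈ {w : IsDedekindDomain.HeightOneSpectrum (NumberField.RingOfIntegers K) |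
            w.under (NumberField.RingOfIntegers ℚ) = Summit.BirchSwinnertonDyer.Rank1Residual.X11b.ratPlace 3} :=
          hset ▸ Set.mem_insert _ _
        have hw₂ : w₂ ∈ {w : IsDedekindDomain.HeightOneSpectrum (NumberField.RingOfIntegers K) |
            w.under (NumberField.RingOfIntegers ℚ) = Summit.BirchSwinnertonDyer.Rank1Residual.X11b.ratPlace 3} :=
          hset ▸ Set.mem_insert_of_mem _ (Set.mem_singleton _)
        rcases hmem𝔭 with rfl | h2
        · exact ⟨w₂, Summit.BirchSwinnertonDyer.Rank1Residual.X11b.mem_of_under_eq_ratPlace (K := K) (p := 3) hw₂,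
            hne.symm⟩
        · rw [Set.mem_singleton_iff] at h2
          subst h2
          exact ⟨w₁, Summit.BirchSwinnertonDyer.Rank1Residual.X11b.mem_of_under_eq_ratPlace (K := K) (p := 3) hw₁,
            hne⟩
      · rw [hset, Set.ncard_singleton] at hcard; exact absurd hcard (by norm_num)
      · rw [hset, Set.ncard_singleton] at hcard; exact absurd hcard (by norm_num)
    obtain ⟨f, hfW, ι', hι', ΩK, Ωp, Q, hΩK, hQ, u, hu1, hu⟩ :=
      frameAtThree h8 h10 W₀ 3 K D₀ H ι P hCM0 hr0 rfl hin0 hbad0 hK hHN hd4 hP hc0 hLt κ hκ γ 𝔭 h𝔭 he hf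
    obtain ⟨n, ⟨htors, g, hg, hg0, hgn⟩, hctl⟩ :=
      controlAtThree hGZ hKo hmod W₀ 3 K D₀ H ι P hCM0 hr0 rfl hin0 hbad0 hK hHN hd4 hP hc0 hLt κ hκ γ 𝔭 h𝔭 he hf
        𝔭' h𝔭' hne'
    have hdiv := hE h9 W₀ 3 K hCM0 hr0 rfl hin0 hbad0 hK hHN hd4 hhK hLt κ hκ γ 𝔭 h𝔭 he hf 𝔭'
      h𝔭' hne' htors f hfW ι' hι' ΩK Ωp Q hΩK hQ
    have hmem : (Summit.BirchSwinnertonDyer.Rank1Residual.X11b.R1.toCpInt 3) (PowerSeries.constantCoeff g) ∈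
        Ideal.span {PowerSeries.constantCoeff Q} := by
      rw [hg, Ideal.map_span, Set.image_singleton] at hdiv
      exact (Ideal.span_singleton_le_iff_mem _).mp hdiv
    obtain ⟨hx0, hle⟩ := key3 hg0 hmem hu1 hu
    rw [Summit.BirchSwinnertonDyer.Rank1Residual.X11b.Halves.valuation_logOmega hx0, hgn] at hle
    haveI := hfin
    haveI : Finite (AddCommGroup.primaryComponent (W₀.baseChange K).sha 3) :=
      Finite.of_injective _ Subtype.val_injective
    have h : 2 * (padicValNat 3 (AddSubgroup.zmultiples P).index : ℤ) ≤
        (padicValNat 3 (Nat.card (AddCommGroup.primaryComponent (W₀.baseChange K).sha 3)) : ℤ) +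
          padicValNat 3 (Summit.BirchSwinnertonDyer.Rank1Residual.X11b.tamagawaProductSplit W₀ K) := by
      push_cast at hle hctl ⊢
      omega
    rw [Summit.BirchSwinnertonDyer.Rank1Residual.X11b.padicValNat_tamagawaProductSplit_eq_of_heegner_prime
        (W := W₀) (K := K) (p := 3) rfl hHN,
      Summit.BirchSwinnertonDyer.Rank1Residual.X11b.padicValNat_tamagawaProduct_baseChange_of_heegner_prime
        (W := W₀) (K := K) (p := 3) hK rfl hHN,
      Literature.NumberTheory.EllipticCurves.padicValNat_card_addPrimaryComponent] at h
    unfold Summit.BirchSwinnertonDyer.Rank1Residual.X11b.IndexLowerBoundAt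
    rw [WeierstrassCurve.shaOrder]
    omega
  exact Literature.NumberTheory.EllipticCurves.Wuthrich2014.bsdp_of_isIsogenous hCassels hiso
    (hGZK W₀ hr0.le).2 (W₀.leadingLCoeff_ne_zero_holds (hmod W₀)) hb0

/-- **The crux BY NAME (route `InertBadSignedBranches`' decl, the first sharing route of the item)** from the four stubs
(the frame is supplied by `frameAtThree`):
`BSD(E,3)` (above) ⇒ the typed missing `3`-part output (`Typed.missingPPartAt_of_bsdp`, `Ш(E)` finite by GZK). -/
theorem inertBadAtThree_of_links :
    BiquadraticEisensteinDescent.PublishedInputsBiquadratic ∧ BiquadraticEisensteinDescent.HsiehAnyLevelInput ∧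
    BiquadraticEisensteinDescent.HsiehMuInvariantInput ∧ BiquadraticEisensteinDescent.LiuZhangZhangAdditiveInput ∧
    Literature.NumberTheory.EllipticCurves.burungaleTian_analyticRank_eq_zero_of_selmerCorank_eq_zero_of_hasCM ∧
    Literature.NumberTheory.EllipticCurves.monsky_selmerCorank_two_mod_two_eq ∧
    (∀ (W : WeierstrassCurve ℚ) [W.IsElliptic], W.HasCM → Literature.NumberTheory.EllipticCurves.smith_selmerCorank_density W) →
    (∀ (N : ℕ), N ≠ 0 → ¬ Literature.NumberTheory.EllipticCurves.twistDensity (fun d : ℤ ↦ ∃ (K : Type) (_ : Field K) (_ : NumberField K), Literature.NumberTheory.EllipticCurves.IsImaginaryQuadratic K ∧ NumberField.discr K = d ∧ 4 < d.natAbs ∧ Odd d ∧ Literature.NumberTheory.EllipticCurves.SatisfiesHeegnerHypothesis N K ∧ ¬ 3 ∣ NumberField.classNumber K) 0) →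
    (∀ (W : WeierstrassCurve ℚ) [W.IsElliptic] [W.IsGloballyMinimal] [NeZero (W.conductorNorm ℤ)] (p : ℕ) [Fact p.Prime] (D : Literature.NumberTheory.EllipticCurves.ModularForms.ModularParametrizationData W (W.conductorNorm ℤ)), W.HasCM → W.analyticRank = 1 → p = 3 → Literature.NumberTheory.EllipticCurves.Rank1Residual.CMInert W p → ¬ Literature.NumberTheory.EllipticCurves.Rank1Residual.Good W p → (∀ z ∈ D.L.lattice, ∃ w ∈ Literature.NumberTheory.EllipticCurves.ModularForms.periodLattice D.f, z = D.c * w) → ¬ (p : ℤ) ∣ D.c) →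
    (Literature.NumberTheory.EllipticCurves.Hsieh2014.thmB_exists_isHsiehLFunction_coeff_norm_eq_one_unrPeriod_anyLevel → ∀ (W : WeierstrassCurve ℚ) [W.IsElliptic] [W.IsGloballyMinimal] (p : ℕ) [Fact p.Prime] [NeZero (W.conductorNorm ℤ)] (K : Type) [Field K] [NumberField K], W.HasCM → W.analyticRank = 1 → p = 3 → Literature.NumberTheory.EllipticCurves.Rank1Residual.CMInert W p → ¬ Literature.NumberTheory.EllipticCurves.Rank1Residual.Good W p → Literature.NumberTheory.EllipticCurves.IsImaginaryQuadratic K → Literature.NumberTheory.EllipticCurves.SatisfiesHeegnerHypothesis (W.conductorNorm ℤ) K → 4 < (NumberField.discr K).natAbs → ¬ p ∣ NumberField.classNumber K → (W.quadraticTwist (NumberField.discr K : ℚ)).entireLFunction 1 ≠ 0 → ∀ (κ : Literature.NumberTheory.EllipticCurves.ZpExtension K p), κ.IsAnticyclotomic → ∀ (γ : Field.absoluteGaloisGroup K) [Fact (κ.IsTopGenerator γ)] (𝔭 : IsDedekindDomain.HeightOneSpectrum (NumberField.RingOfIntegers K)), ((p : ℕ) : NumberField.RingOfIntegers K) ∈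 𝔭.asIdeal → 𝔭.asIdeal.ramificationIdx (NumberField.RingOfIntegers ℚ) = 1 → 𝔭.asIdeal.inertiaDeg (NumberField.RingOfIntegers ℚ) = 1 → ∀ (𝔭' : IsDedekindDomain.HeightOneSpectrum (NumberField.RingOfIntegers K)), ((p : ℕ) : NumberField.RingOfIntegers K) ∈ 𝔭'.asIdeal → 𝔭' ≠ 𝔭 → Module.IsTorsion (Literature.NumberTheory.EllipticCurves.IwasawaAlgebra p) (Summit.BirchSwinnertonDyer.Rank1Residual.X11b.AcSelmer.XAc (W.baseChange K) p κ 𝔭' ∅ γ) → ∀ (f : CuspForm (CongruenceSubgroup.Gamma0 (W.conductorNorm ℤ)) 2), Literature.NumberTheory.EllipticCurves.ModularForms.IsNewformOf W f → ∀ (ι' : PadicAlgCl p ≃+* ℂ), (∀ (w : NumberField.InfinitePlace K) (k : NumberField.RingOfIntegers K), k ∈ 𝔭.asIdeal ↔ ‖ι'.symm (w.embedding (k : K))‖ < 1) → ∀ (ΩK : ℂ) (Ωp : (Literature.NumberTheory.EllipticCurves.unrIntegers p)ˣ) (Q : PowerSeries (PadicComplexInt p)), ΩK ≠ 0 → Summit.BirchSwinnertonDyer.Rank1Residual.X11b.R1.IsBDPLFunctionInt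 p ι' 𝔭 κ γ f ΩK ((Ωp : Literature.NumberTheory.EllipticCurves.unrIntegers p) : (PadicComplex p)) Q → (Summit.BirchSwinnertonDyer.Rank1Residual.X11b.AcSelmer.XAc.charIdeal (W.baseChange K) p κ 𝔭' ∅ γ).map ((Summit.BirchSwinnertonDyer.Rank1Residual.X11b.R1.toCpInt p).comp (PowerSeries.constantCoeff : Literature.NumberTheory.EllipticCurves.IwasawaAlgebra p →+* ℤ_[p])) ≤ Ideal.span {PowerSeries.constantCoeff Q}) →
    InertBadSignedBranches.InertBadAtThree := by
  intro hI hC hR hE W _ _ _ hCM hr hin hbad _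
  have hGZK : Literature.NumberTheory.EllipticCurves.rank_eq_analyticRank_of_analyticRank_le_one := hI.1.2.2.2.1
  haveI : Finite W.sha := (hGZK W hr.le).2
  exact Literature.NumberTheory.EllipticCurves.Rank1Residual.Typed.missingPPartAt_of_bsdp W 3
    (bsdp_three_of_links hI hC hR hE W hCM hr hin hbad)

/-- **The same crux under route `BiquadraticEisensteinDescent`'s decl** (identical body). -/
theorem inertBadAtThree_bed_of_links :
    BiquadraticEisensteinDescent.PublishedInputsBiquadratic ∧ BiquadraticEisensteinDescent.HsiehAnyLevelInput ∧
    BiquadraticEisensteinDescent.HsiehMuInvariantInput ∧ BiquadraticEisensteinDescent.LiuZhangZhangAdditiveInput ∧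
    Literature.NumberTheory.EllipticCurves.burungaleTian_analyticRank_eq_zero_of_selmerCorank_eq_zero_of_hasCM ∧
    Literature.NumberTheory.EllipticCurves.monsky_selmerCorank_two_mod_two_eq ∧
    (∀ (W : WeierstrassCurve ℚ) [W.IsElliptic], W.HasCM → Literature.NumberTheory.EllipticCurves.smith_selmerCorank_density W) →
    (∀ (N : ℕ), N ≠ 0 → ¬ Literature.NumberTheory.EllipticCurves.twistDensity (fun d : ℤ ↦ ∃ (K : Type) (_ : Field K) (_ : NumberField K), Literature.NumberTheory.EllipticCurves.IsImaginaryQuadratic K ∧ NumberField.discr K = d ∧ 4 < d.natAbs ∧ Odd d ∧ Literature.NumberTheory.EllipticCurves.SatisfiesHeegnerHypothesis N K ∧ ¬ 3 ∣ NumberField.classNumber K) 0) →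
    (∀ (W : WeierstrassCurve ℚ) [W.IsElliptic] [W.IsGloballyMinimal] [NeZero (W.conductorNorm ℤ)] (p : ℕ) [Fact p.Prime] (D : Literature.NumberTheory.EllipticCurves.ModularForms.ModularParametrizationData W (W.conductorNorm ℤ)), W.HasCM → W.analyticRank = 1 → p = 3 → Literature.NumberTheory.EllipticCurves.Rank1Residual.CMInert W p → ¬ Literature.NumberTheory.EllipticCurves.Rank1Residual.Good W p → (∀ z ∈ D.L.lattice, ∃ w ∈ Literature.NumberTheory.EllipticCurves.ModularForms.periodLattice D.f, z = D.c * w) → ¬ (p : ℤ) ∣ D.c) →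
    (Literature.NumberTheory.EllipticCurves.Hsieh2014.thmB_exists_isHsiehLFunction_coeff_norm_eq_one_unrPeriod_anyLevel → ∀ (W : WeierstrassCurve ℚ) [W.IsElliptic] [W.IsGloballyMinimal] (p : ℕ) [Fact p.Prime] [NeZero (W.conductorNorm ℤ)] (K : Type) [Field K] [NumberField K], W.HasCM → W.analyticRank = 1 → p = 3 → Literature.NumberTheory.EllipticCurves.Rank1Residual.CMInert W p → ¬ Literature.NumberTheory.EllipticCurves.Rank1Residual.Good W p → Literature.NumberTheory.EllipticCurves.IsImaginaryQuadratic K → Literature.NumberTheory.EllipticCurves.SatisfiesHeegnerHypothesis (W.conductorNorm ℤ) K → 4 < (NumberField.discr K).natAbs → ¬ p ∣ NumberField.classNumber K → (W.quadraticTwist (NumberField.discr K : ℚ)).entireLFunction 1 ≠ 0 → ∀ (κ : Literature.NumberTheory.EllipticCurves.ZpExtension K p), κ.IsAnticyclotomic → ∀ (γ : Field.absoluteGaloisGroup K) [Fact (κ.IsTopGenerator γ)] (𝔭 : IsDedekindDomain.HeightOneSpectrum (NumberField.RingOfIntegers K)), ((p : ℕ) : NumberField.RingOfIntegers K) ∈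 𝔭.asIdeal → 𝔭.asIdeal.ramificationIdx (NumberField.RingOfIntegers ℚ) = 1 → 𝔭.asIdeal.inertiaDeg (NumberField.RingOfIntegers ℚ) = 1 → ∀ (𝔭' : IsDedekindDomain.HeightOneSpectrum (NumberField.RingOfIntegers K)), ((p : ℕ) : NumberField.RingOfIntegers K) ∈ 𝔭'.asIdeal → 𝔭' ≠ 𝔭 → Module.IsTorsion (Literature.NumberTheory.EllipticCurves.IwasawaAlgebra p) (Summit.BirchSwinnertonDyer.Rank1Residual.X11b.AcSelmer.XAc (W.baseChange K) p κ 𝔭' ∅ γ) → ∀ (f : CuspForm (CongruenceSubgroup.Gamma0 (W.conductorNorm ℤ)) 2), Literature.NumberTheory.EllipticCurves.ModularForms.IsNewformOf W f → ∀ (ι' : PadicAlgCl p ≃+* ℂ), (∀ (w : NumberField.InfinitePlace K) (k : NumberField.RingOfIntegers K), k ∈ 𝔭.asIdeal ↔ ‖ι'.symm (w.embedding (k : K))‖ < 1) → ∀ (ΩK : ℂ) (Ωp : (Literature.NumberTheory.EllipticCurves.unrIntegers p)ˣ) (Q : PowerSeries (PadicComplexInt p)), ΩK ≠ 0 → Summit.BirchSwinnertonDyer.Rank1Residual.X11b.R1.IsBDPLFunctionInt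 p ι' 𝔭 κ γ f ΩK ((Ωp : Literature.NumberTheory.EllipticCurves.unrIntegers p) : (PadicComplex p)) Q → (Summit.BirchSwinnertonDyer.Rank1Residual.X11b.AcSelmer.XAc.charIdeal (W.baseChange K) p κ 𝔭' ∅ γ).map ((Summit.BirchSwinnertonDyer.Rank1Residual.X11b.R1.toCpInt p).comp (PowerSeries.constantCoeff : Literature.NumberTheory.EllipticCurves.IwasawaAlgebra p →+* ℤ_[p])) ≤ Ideal.span {PowerSeries.constantCoeff Q}) →
    BiquadraticEisensteinDescent.InertBadAtThree :=
  inertBadAtThree_of_links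


end Summit.BirchSwinnertonDyer.BirchSwinnertonDyer.Theorems.InertBadSignedBranchesInertBadAtThreeBedGlue

end
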